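import Literature.NumberTheory.Automorphic.SatakeIsomorphismGLNormalisations   -- ★ `satakeTransform_deltaHalf_mem_weylInvariants` (δ^{1/2} normalisation)
import Literature.NumberTheory.Automorphic.GLnHeckeSphericalMapImage            -- ★ `weylInvariants_glWeylGroup_eq_adjoin` (generators `x^{-𝟙}`, `e_r`)
import Literature.NumberTheory.Automorphic.SphericalHeckeEigenvaluesGL            -- ★ `laurentEvalAt`, `laurentMonomialHom`, `laurentEvalAt_single`
import HarnessLib

/-!
# R90 · S6 «Ch. 14.1–14.5 stable TF» — W10-e: the spherical Hecke eigencharacters of `GL_n` are `S_n`-SYMMETRIC in the Satake parameter —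
# `λ_{zz ∘ σ}(φ) = λ_{zz}(φ)` for every permutation `σ`, generic `n` (`Theorems/R90S6GLHeckeEigencharacterPerm.lean`)

Cell `hodgecm-mathlib`, crux H413 (`stmt-HodgeConjecture-24833`), route of record `HCCMUnconditional`; programme R90-TF, section S6 (base `R90-C14`),
seat R90-C14-p02 (g2); card W10-e (S6 dealer R90-C14-plan (g2) 2026-09-05T00:32Z «GL-SIDE `S_n`-SYMMETRY OF THE SPHERICAL EIGENCHARACTER, GENERIC `n`»).
Helper lane `--supports stmt-HodgeConjecture-24833 --as helper`; THEOREMS ONLY (no definition, no instance, no notation, no named fact, no `sorry`); imports = ★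
Literature Satake files + HarnessLib (no `Cruxes` import).  The `GL_n` twin of the unitary-side ★ `heckeEigencharacter_comp_perm`
[HyperspecialUnitaryHeckeEigencharacterWeylInvariance]; my `n = 2` swap ★ `R90.S6.glTwoHeckeEigencharacter_swap` [Theorems/R90S6EtaGraphJScalar] is its first
instance (kept there, cited — not moved).

THE MATHEMATICS [CartierCorvallis1979, §IV (4.2)–(4.4), Thm. 4.1]: the Satake transform of `ℋ(GL_n(K), GL_n(𝒪))` in the unitary (`δ^{1∕2}`) normalisation lands in
the `S_n`-invariants `ℂ[ℤⁿ]^{S_n} = ℂ[e_1, …, e_n, (x_1⋯x_n)⁻¹]` (★ `satakeTransform_deltaHalf_mem_weylInvariants`, ★ `weylInvariants_glWeylGroup_eq_adjoin`), and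
every generator takes the same value at `zz` and at `zz ∘ σ` (`e_r(zz ∘ σ) = Σ_{#t = r} Π_{i ∈ t} zz_{σ i} = Σ_{#t′ = r} Π_{j ∈ t′} zz_j`, `t′ = σ(t)`;
`(Π zz_{σ i})⁻¹ = (Π zz_j)⁻¹`); hence `P(zz ∘ σ) = P(zz)` for every `P ∈ ℂ[ℤⁿ]^{S_n}` and `λ_{zz ∘ σ}(φ) = λ_{zz}(φ)` — «the unramified principal series
`I(χ)` and `I(χ^w)` have the same spherical eigencharacter» (print: [Rogawski1990, §4.5 p. 45] «class of unramified characters of `T` under conjugacy by the Weyl group»).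

* §1 `laurentEvalAt_comp_perm_single_const` (the generator `x^{c𝟙}`), `laurentEvalAt_comp_perm_esymm` (the generators `e_r`, reindexing the subsets by `σ`),
  **`laurentEvalAt_comp_perm`** (`P(zz ∘ σ) = P(zz)` for `P ∈ weylInvariants ℂ (Fin n → ℤ) (glWeylGroup n)`, `Algebra.adjoin_induction`).
* §2 **`glHeckeEigencharacter_comp_perm`**: for ANY field `K` with a DVR valuation ring, finite residue field `q`, `(GL_n(K), GL_n(𝒪))` a Hecke pair, uniformizer
  `ϖ`, a unit square root `u` of `q` and the `δ_B^{1∕2}` weight `wt` (★ p09's `GL` letters, generic `n`):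
  `(isIwasawaExponent_gl hϖ).heckeEigencharacter wt (laurentMonomialHom (zz ∘ σ)) φ = (isIwasawaExponent_gl hϖ).heckeEigencharacter wt (laurentMonomialHom zz) φ`.
HONEST LABEL: local spherical Hecke-algebra bookkeeping; count-neutral helper (well-definedness of graph partners under reordering of parameters, E1.4.4.x).  HC_CM is
proved only modulo the 7 printed citations (2 remaining named inputs: hLiu418 = stmt-HodgeConjecture-24832, h413 = stmt-HodgeConjecture-24833) until rung 0 closes;
REL ≠ ★ ≠ BUILT.

## Tree search
★ `weylInvariants_glWeylGroup_eq_adjoin` [GLnHeckeSphericalMapImage.lean:123], ★ `satakeTransform_deltaHalf_mem_weylInvariants` [SatakeIsomorphismGLNormalisations.lean:305],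
★ `laurentEvalAt_single` [SphericalHeckeEigenvaluesGL.lean:88]; unitary side ★ `heckeEigencharacter_comp_perm` [HyperspecialUnitaryHeckeEigencharacterWeylInvariance.lean:49];
`n = 2`: ★ `glTwoHeckeEigencharacter_swap` (p02, W10-d).  Mathlib `Finset.sum_equiv`, `Equiv.finsetCongr`, `Equiv.prod_comp`, `Finset.mem_map'`.
Dedup: `lean search "laurentEvalAt_comp_perm|glHeckeEigencharacter_comp_perm"` — no hit.

## References
* [CartierCorvallis1979] P. Cartier, *Representations of 𝔭-adic groups: a survey*, PSPM 33.1 (1979), §IV (4.2)–(4.4), Thm. 4.1, Cor. 4.2.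
* [Rogawski1990] J. D. Rogawski, *Automorphic Representations of Unitary Groups in Three Variables*, Ann. of Math. Stud. 123 (1990), §4.5 p. 45.
* [AndrianovZhuravlev2015] A. N. Andrianov, V. G. Zhuravlev, *Modular Forms and Hecke Operators*, Ch. 3 §2.3 Thm. 2.20.
-/

set_option autoImplicit false
-- the mandated namespace repeats the single-problem summit's segment (`HodgeConjecture.HodgeConjecture`)
set_option linter.dupNamespace false

noncomputable section

open Literature.NumberTheory.Automorphic

namespace Summit.HodgeConjecture.HodgeConjecture.R90.S6

variable {n : ℕ}

/-! ## §1 `S_n`-symmetry of point evaluations of `ℂ[ℤⁿ]^{S_n}` -/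

/-- The generator `x^{c𝟙} = (x_1⋯x_n)^c` takes the same value at `zz ∘ σ` and `zz` (`Π_i zz_{σ i}^c = Π_j zz_j^c`). [folklore] -/
theorem laurentEvalAt_comp_perm_single_const (zz : Fin n → ℂˣ) (σ : Equiv.Perm (Fin n)) (c : ℤ) (r : ℂ) :
    laurentEvalAt (zz ∘ σ) (AddMonoidAlgebra.single (fun _ : Fin n => c) r) =
      laurentEvalAt zz (AddMonoidAlgebra.single (fun _ : Fin n => c) r) := by
  rw [laurentEvalAt_single, laurentEvalAt_single]
  congr 1
  exact Equiv.prod_comp σ (fun j => ((zz j : ℂ)) ^ c)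

/-- The indicator monomial of `t` at `zz ∘ σ` is the indicator monomial of `σ(t)` at `zz`. [folklore] -/
theorem laurentEvalAt_comp_perm_single_indicator (zz : Fin n → ℂˣ) (σ : Equiv.Perm (Fin n)) (t : Finset (Fin n)) :
    laurentEvalAt (zz ∘ σ) (AddMonoidAlgebra.single (fun i => if i ∈ t then (1 : ℤ) else 0) (1 : ℂ)) =
      laurentEvalAt zz (AddMonoidAlgebra.single (fun i => if i ∈ t.map σ.toEmbedding then (1 : ℤ) else 0) (1 : ℂ)) := by
  rw [laurentEvalAt_single, laurentEvalAt_single, one_mul, one_mul]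
  rw [← Equiv.prod_comp σ (fun j => ((zz j : ℂ)) ^ (if j ∈ t.map σ.toEmbedding then (1 : ℤ) else 0))]
  refine Finset.prod_congr rfl fun i _ => ?_
  have h : σ i ∈ t.map σ.toEmbedding ↔ i ∈ t := Finset.mem_map' σ.toEmbedding
  simp only [Function.comp_apply, h]

/-- **The elementary symmetric generators `e_r` take the same value at `zz ∘ σ` and `zz`** (reindex the `r`-subsets by `σ`). [folklore]
[cite: AndrianovZhuravlev2015, Ch. 3 §2.3 Thm. 2.20] -/
theorem laurentEvalAt_comp_perm_esymm (zz : Fin n → ℂˣ) (σ : Equiv.Perm (Fin n)) (k : ℕ) :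
    laurentEvalAt (zz ∘ σ) (∑ t ∈ Finset.powersetCard k (Finset.univ : Finset (Fin n)),
        AddMonoidAlgebra.single (fun i => if i ∈ t then (1 : ℤ) else 0) (1 : ℂ)) =
      laurentEvalAt zz (∑ t ∈ Finset.powersetCard k (Finset.univ : Finset (Fin n)),
        AddMonoidAlgebra.single (fun i => if i ∈ t then (1 : ℤ) else 0) (1 : ℂ)) := by
  rw [map_sum, map_sum]
  refine Finset.sum_equiv σ.finsetCongr (fun t => ?_) (fun t _ => ?_)
  · simp only [Finset.mem_powersetCard, Finset.subset_univ, true_and, Equiv.finsetCongr_apply, Finset.card_map]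
  · rw [Equiv.finsetCongr_apply]
    exact laurentEvalAt_comp_perm_single_indicator zz σ t

/-- **`S_n`-SYMMETRY: `P(zz ∘ σ) = P(zz)` for every symmetric Laurent polynomial `P ∈ ℂ[ℤⁿ]^{S_n}`** and every permutation `σ` of the coordinates
(`ℂ[ℤⁿ]^{S_n} = ℂ[e_1, …, e_n, (x_1⋯x_n)⁻¹]`, ★ `weylInvariants_glWeylGroup_eq_adjoin`; the generators are symmetric).
[cite: CartierCorvallis1979, §IV Thm. 4.1] [cite: AndrianovZhuravlev2015, Ch. 3 §2.3 Thm. 2.20] -/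
theorem laurentEvalAt_comp_perm {P : AddMonoidAlgebra ℂ (Fin n → ℤ)}
    (hP : P ∈ weylInvariants ℂ (Fin n → ℤ) (ConnectedReductiveGroupData.glWeylGroup n)) (zz : Fin n → ℂˣ) (σ : Equiv.Perm (Fin n)) :
    laurentEvalAt (zz ∘ σ) P = laurentEvalAt zz P := by
  rw [weylInvariants_glWeylGroup_eq_adjoin n ℂ] at hP
  induction hP using Algebra.adjoin_induction with
  | mem x hx =>
    rcases hx with rfl | ⟨r, rfl⟩
    · exact laurentEvalAt_comp_perm_single_const zz σ (-1) 1
    · exact laurentEvalAt_comp_perm_esymm zz σ ((r : ℕ) + 1)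
  | algebraMap r => rw [AlgHom.commutes, AlgHom.commutes]
  | add x y _ _ hx hy => rw [map_add, map_add, hx, hy]
  | mul x y _ _ hx hy => rw [map_mul, map_mul, hx, hy]

/-! ## §2 The spherical Hecke eigencharacters of `GL_n` are `S_n`-symmetric in the parameter -/

section GLn

open scoped MatrixGroups
open ValuativeRel

universe u

variable {K : Type u} [Field K] [ValuativeRel K] [IsDiscreteValuationRing 𝒪[K]] [Finite 𝓀[K]] {ϖ : K}
  [IsHeckeTriple (⊤ : Submonoid (GL (Fin n) K)) (glInt n K) (glInt n K)]

/-- **W10-e `glHeckeEigencharacter_comp_perm` — `λ_{zz ∘ σ}(φ) = λ_{zz}(φ)`.**  For a non-archimedean field `K` (DVR valuation ring, finite residue field of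
cardinality `q`; `(GL_n(K), GL_n(𝒪))` a Hecke pair), a uniformizer `ϖ`, a unit square root `u` of `q`, the `δ_B^{1∕2}` Satake weight `wt(e) = u^{(n−1)|e| − 2⟨ν, e⟩}` (the UNITARY
normalisation), every `φ ∈ ℋ(GL_n(K), GL_n(𝒪))`, every parameter `zz ∈ (ℂˣ)ⁿ` and every `σ ∈ S_n`: the spherical eigencharacter (`λ = ev ∘ 𝒮_{δ^{1∕2}}`, ★
`IsIwasawaExponent.heckeEigencharacter` of ★ `isIwasawaExponent_gl`) satisfies `λ_{zz ∘ σ}(φ) = λ_{zz}(φ)` (`𝒮_{δ^{1∕2}}(φ) ∈ ℂ[ℤⁿ]^{S_n}`, ★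
`satakeTransform_deltaHalf_mem_weylInvariants`, and `laurentEvalAt_comp_perm`).  The `GL_n` twin of the unitary-side ★ `heckeEigencharacter_comp_perm`.
[cite: CartierCorvallis1979, §IV (4.2)–(4.4), Thm. 4.1] [cite: Rogawski1990, §4.5 p. 45] -/
theorem glHeckeEigencharacter_comp_perm (hϖ : IsUniformizingElement ϖ) {u : ℂˣ}
    (hu : (u : ℂ) ^ 2 = ((Nat.card 𝓀[K] : ℕ) : ℂ)) {wt : Multiplicative (Fin n → ℤ) →* ℂ}
    (hwt : ∀ e : Fin n → ℤ,
      wt (Multiplicative.ofAdd e) = ((u ^ (((n : ℤ) - 1) * (∑ i, e i) - 2 * satakeTwistExp e) : ℂˣ) : ℂ))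
    (φ : heckeAlgebra ℂ (GL (Fin n) K) (glInt n K)) (zz : Fin n → ℂˣ) (σ : Equiv.Perm (Fin n)) :
    (isIwasawaExponent_gl hϖ).heckeEigencharacter wt (laurentMonomialHom (zz ∘ σ)) φ =
      (isIwasawaExponent_gl hϖ).heckeEigencharacter wt (laurentMonomialHom zz) φ :=
  laurentEvalAt_comp_perm (satakeTransform_deltaHalf_mem_weylInvariants hϖ hu hwt φ) zz σ

end GLn

end Summit.HodgeConjecture.HodgeConjecture.R90.S6

end
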